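import Mathlib
import Literature.Analysis.FluidPDE.TypeIAncientMildRssPullback
import Summits.NavierStokesRegularity.NavierStokesRegularity.Theorems.EulerZoomLiouvillePowerGaugeEulerLiouvilleRigidFrameNoBackground
import HarnessLib

/-!
# PRECESSING-FRAME-STEADY PAST MEMBERS ARE TRIVIAL — `IsPastSteady` alternative «R(τ) = exp(τ A(τ))» (LEAD key K-w3-STAG)
# (crux `EulerZoomLiouville.PowerGaugeEulerLiouville` = stmt-NavierStokesRegularity-19832; corollary of the E(3)-steady stratum; width seat ns-ezl-w3 g6)

Route №10 `EulerZoomLiouville` (NavierStokesRegularity), crux E.  A member of Seregin's power-gauged class that is, below some `T₁ ≤ 0`, a fixed profile seen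
in a PRECESSING frame with background,
`u(τ, y) = e^{τA(τ)} U(e^{−τA(τ)}(y − ξ(τ))) + η(τ)` (`A : ℝ → skew(ℝ³)` and `ξ` of class `C¹` — a rotation with TIME-DEPENDENT AXIS and angle),
vanishes a.e. on the slab (`RigidFrame.ae_eq_zero_of_gauge_of_pastPrecessingFrameSteady`).  COROLLARY of `IsPastSteady` alternative 9
(`RigidFrame.ae_eq_zero_of_gauge_of_pastRigidFrameSteady_background`, ns-ezl-w3 g6 p677943): `τ ↦ e^{τA(τ)}` is a `C¹` path of linear isometries
(`rss_exists_rot`: `e^{τB}` is an isometry with inverse `e^{−τB}` for skew `B`; `NormedSpace.exp` is analytic on the Banach algebra `ℝ³ →L ℝ³`).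

WHAT THIS IS NOT: not NS regularity, not the crux E — a symmetry stratum of the crux CLASS 19832 (MODEL lattice; E/NS strata), `--supports` stmt-19832;
19832 OPEN. [folklore]
-/

noncomputable section

-- flat `Theorems/<Route><Decl>…` files of one crux share the namespace of the crux (tree convention: `Summit.<S>.<S>.…`)
set_option linter.dupNamespace false

open MeasureTheory Set Filter Topology Metric Function TopologicalSpace
open scoped ENNReal NNReal RealInnerProductSpace

namespace Summit.NavierStokesRegularity.NavierStokesRegularity.Theorems.PowerGaugeEulerLiouville

namespace RigidFrame

open Literature.Analysis Literature.Analysis.FluidPDE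

/-- **PRECESSING-FRAME-STEADY PAST MEMBERS ARE TRIVIAL** (`0 < ρ ≤ 1/2`).  Crux hypotheses verbatim; `A : ℝ → (ℝ³ →L ℝ³)` a `C¹` path of SKEW maps
(`⟪A(τ)x, x⟫ = 0`), `ξ` a `C¹` centre path, `η` any background, and `u(τ, ·) = e^{τA(τ)} U(e^{−τA(τ)}(· − ξ(τ))) + η(τ)` for all `τ < T₁ ≤ 0`.  Then `u = 0` a.e.
on the slab. [folklore] -/
theorem ae_eq_zero_of_gauge_of_pastPrecessingFrameSteady {ρ : ℝ} (hρ : 0 < ρ) (hρ2 : ρ ≤ 1 / 2)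
    {u : ℝ → EuclideanSpace ℝ (Fin 3) → EuclideanSpace ℝ (Fin 3)} {p : ℝ → EuclideanSpace ℝ (Fin 3) → ℝ}
    {H : ℝ → EuclideanSpace ℝ (Fin 3) → EuclideanSpace ℝ (Fin 3) →L[ℝ] EuclideanSpace ℝ (Fin 3)} {c : ℝ≥0} {T₁ : ℝ}
    {U : EuclideanSpace ℝ (Fin 3) → EuclideanSpace ℝ (Fin 3)}
    {A : ℝ → EuclideanSpace ℝ (Fin 3) →L[ℝ] EuclideanSpace ℝ (Fin 3)} {ξ η : ℝ → EuclideanSpace ℝ (Fin 3)}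
    (hsw : IsSuitableWeakSolutionOn (slab (EuclideanSpace ℝ (Fin 3)) (Iio 0) isOpen_Iio) 0 0 u p)
    (hH : HasWeakSpatialGradientOn (slab (EuclideanSpace ℝ (Fin 3)) (Iio 0) isOpen_Iio) u H)
    (hc : ∀ a : ℝ, 0 < a → ENNReal.ofReal (a ^ (2 * ρ)) * cknA a (0 : ℝ × EuclideanSpace ℝ (Fin 3)) u +
        ENNReal.ofReal (a ^ ρ) * cknE a (0 : ℝ × EuclideanSpace ℝ (Fin 3)) H +
        ENNReal.ofReal (a ^ (2 * ρ)) * cknD a (0 : ℝ × EuclideanSpace ℝ (Fin 3)) p ≤ (c : ℝ≥0∞))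
    (hT₁ : T₁ ≤ 0) (hA : ContDiff ℝ 1 A) (hAskew : ∀ τ x, ⟪A τ x, x⟫ = 0) (hξ : ContDiff ℝ 1 ξ)
    (hu : ∀ τ : ℝ, τ < T₁ → u τ = fun y =>
      NormedSpace.exp (τ • A τ) (U (NormedSpace.exp (-(τ • A τ)) (y - ξ τ))) + η τ) :
    uncurry u =ᵐ[volume.restrict (Iio (0 : ℝ) ×ˢ (univ : Set (EuclideanSpace ℝ (Fin 3))))] 0 := by
  -- the isometries `R τ = e^{τA(τ)}`, `(R τ)⁻¹ = e^{−τA(τ)}`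
  have hrot : ∀ τ : ℝ, ∃ L : EuclideanSpace ℝ (Fin 3) ≃ₗᵢ[ℝ] EuclideanSpace ℝ (Fin 3),
      (∀ y, L y = NormedSpace.exp (τ • A τ) y) ∧ ∀ y, L.symm y = NormedSpace.exp (-(τ • A τ)) y := by
    intro τ
    obtain ⟨L, h1, h2⟩ := rss_exists_rot (hAskew τ) (-τ)
    refine ⟨L, fun y => ?_, fun y => ?_⟩
    · rw [h1, neg_neg]
    · rw [h2, neg_smul]
  choose R hR1 hR2 using hrot
  -- the member in the rigid-frame form of alternative 9
  have hu' : ∀ τ : ℝ, τ < T₁ → u τ = fun y => R τ (U ((R τ).symm (y - ξ τ))) + η τ := by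
    intro τ hτ
    rw [hu τ hτ]
    funext y
    rw [hR1, hR2]
  -- `τ ↦ (R τ : ℝ³ →L ℝ³) = e^{τA(τ)}` is `C¹`
  have hRfun : (fun τ => (R τ : EuclideanSpace ℝ (Fin 3) →L[ℝ] EuclideanSpace ℝ (Fin 3))) =
      fun τ => NormedSpace.exp (τ • A τ) := by
    funext τ
    apply ContinuousLinearMap.ext
    intro y
    rw [← hR1 τ y]
    rfl
  have hRc : ContDiff ℝ 1 (fun τ => (R τ : EuclideanSpace ℝ (Fin 3) →L[ℝ] EuclideanSpace ℝ (Fin 3))) := by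
    rw [hRfun]
    have hsm : ContDiff ℝ 1 (fun τ : ℝ => τ • A τ) := contDiff_id.smul hA
    exact contDiff_iff_contDiffAt.2 fun τ =>
      ((NormedSpace.exp_analytic (𝕂 := ℝ) (τ • A τ)).contDiffAt).comp τ hsm.contDiffAt
  exact ae_eq_zero_of_gauge_of_pastRigidFrameSteady_background hρ hρ2 hsw hH hc hT₁ hRc hξ hu'

end RigidFrame

end Summit.NavierStokesRegularity.NavierStokesRegularity.Theorems.PowerGaugeEulerLiouville

end
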